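import Summits.BirchSwinnertonDyer.BirchSwinnertonDyer.Theorems.Rank1ResidualX9ChaCertificate
import Literature.NumberTheory.EllipticCurves.Miller2011.JetchevBoundIrreducible
import Literature.NumberTheory.EllipticCurves.Rank1Residual.Typed.CasselsLowerBound
import HarnessLib

/-!
# BSD rank-≤1 residual cell, class X9: the Tamagawa-obstructed pairs — Miller 2011 Thm. 5.4
# (Jetchev's sharpening) under Cha's hypotheses, per pair

HONEST FRAMING (cell `b2b-bsdres-*`, verbatim): the goal of the cell is to DELETE the
COMBINATION-SHAPED residual classes for ALL analytic-rank ≤ 1 curves over ℚ — "full BSD formula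
for every rank ≤ 1 curve in class C" assembled STRICTLY from published theorems — so that the
rank-≤1 remainder becomes exactly the CONSTRUCTION-SHAPED classes, which are TYPED (missing-input
Props), NOT attempted; this is not "finishing BSD".

Theorems only (helper file of the statement item `SelmerRankSmallImage`,
stmt-BirchSwinnertonDyer-14418; X9 prover GEN 7, unit `b2b-bsdres-x9-g7`). Gen 6's
`Rank1ResidualX9ChaCertificate.lean` delivers the typed target `BSDpOnClassX9` pointwise on the
Cha-certificate locus `p ∤ [E(K) : ℤ y_K]`. At an X9 pair where `p` divides a Tamagawa number
`c_q` that locus is EMPTY for every Heegner field (Gross–Zagier + BSD force `c_q ∣ I_K`; GJPST 2009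
Rem. 3.13) — in the cell's extension run (gen 6/7, all 790 X9 pairs `N < 5·10⁵`, first Heegner
field) this is the shape of 102 of the 138 rows with `p ∣ m`. The printed lever there is Miller
2011 Thm. 5.4 = Jetchev's Tamagawa sharpening, which Miller states under Cha's hypotheses as well
(tree fact `Miller2011.thm54_cha_padicValNat_shaOrder_add_tamagawa_le`, FLAG
`Miller11-Thm54-Cha-case`: Jetchev 2008 prints Cor. 1.5 under surjectivity; see that file's
docstring). This file is its X9 consumer:
* `noPTorsion_of_millerJetchev_of_index_le_tamagawa`, `bsdp_of_millerJetchev_of_index_le_tamagawa`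
  — general per-curve form (any non-CM `E`, odd `p`, irreducible `E[p]`): the certificate is a
  Heegner field `K` (`p ∤ d_K`, `p² ∤ N`), a Heegner point `P` of infinite order, ONE prime `q ∣ N`
  with `ord_p [E(K) : ℤ P] ≤ ord_p c_q`, and `p ∤ #Ш_an` ⇒ `Ш(E/ℚ)[p] = 0` and `BSD(E,p)`;
* `bsdp_of_classX9_of_jetchevChaCertificate` — the same over this file's `ClassX9` (Galois
  hypotheses automatic), i.e. `BSDpOnClassX9` delivered pointwise on the Jetchev–Cha locus;
* `missingInputAt_of_classX9_of_jetchevChaCertificate` — the typed missing input of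
  `Typed/X9.lean` discharged there (bookkeeping);
* `mu_eq_zero_of_classX9_of_jetchevChaCertificate` — analytic rank 0: Greenberg's `μ = 0` FOLLOWS
  at such pairs (gen 5's μ-typing), so the typed residue is settled there, not bypassed.
Nothing here is a class theorem; `BSDpOnClassX9` / `IntegralMainConjectureOnClassX9` stay OPEN as
∀-statements; X9's label is unchanged; every booking through this file carries the flag.
Typical certificate (cell table `HOME/b2b-bsdres-x9/X9-CENSUS-G7.md`): 608e1 at `p = 5`
(image `5Ns`, `r_an = 1`, `K = ℚ(√−31)`, `m = 20`, `c_19 = 5 = I_5` split, all other `c_q`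
prime to 5, `#Ш_an = 1`) — GJPST 2009's own example 608b needed Cha; 608e needs Cha AND Jetchev.
-/

set_option linter.dupNamespace false

noncomputable section

open scoped Classical MatrixGroups ModularForm

open CongruenceSubgroup WeierstrassCurve Literature.NumberTheory.EllipticCurves
  Literature.NumberTheory.EllipticCurves.ModularForms
  Literature.NumberTheory.EllipticCurves.Rank1Residual
  Literature.NumberTheory.EllipticCurves.Miller2011

namespace Summit.BirchSwinnertonDyer.BirchSwinnertonDyer.Rank1Residual

/-- **The Jetchev–Cha index certificate gives `Ш(E/ℚ)[p] = 0`.** For a non-CM `E/ℚ` of analytic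
rank `≤ 1`, an imaginary quadratic `K` with the Heegner hypothesis for the level `N`, a Heegner point
`P = y_K` of infinite order, an odd prime `p` with `p ∤ d_K`, `p² ∤ N`, `ρ̄_{E,p}` irreducible, and a
prime `q ∣ N` with `ord_p [E(K) : ℤ P] ≤ ord_p c_q(E)`: Miller's Thm. 5.4 under Cha's hypotheses
(`hMJ`, flag `Miller11-Thm54-Cha-case`) gives `ord_p #Ш(E/ℚ) = 0`, `Ш(E/ℚ)` is finite by
Gross–Zagier–Kolyvagin (`hGZK`), hence no nonzero class is killed by `p`.
[cite: Miller2011LMS, Thm. 5.4 (arXiv:1010.2431 p. 11)] -/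
theorem noPTorsion_of_millerJetchev_of_index_le_tamagawa
    (hMJ : thm54_cha_padicValNat_shaOrder_add_tamagawa_le)
    (hGZK : rank_eq_analyticRank_of_analyticRank_le_one)
    (W : WeierstrassCurve ℚ) [W.IsElliptic] [W.IsGloballyMinimal] (p : ℕ) [Fact p.Prime]
    {N : ℕ} [NeZero N] {K : Type} [Field K] [NumberField K] (hK : IsImaginaryQuadratic K)
    (hH : SatisfiesHeegnerHypothesis N K) {P : (W.baseChange K).toAffine.Point}
    (hP : IsHeegnerPoint N W K P) (hnt : ¬ IsOfFinAddOrder P)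
    (q : ℕ) [Fact q.Prime] (hqN : q ∣ N)
    (hcm : ¬ W.HasCM) (hp2 : p ≠ 2) (hpD : ¬ (p : ℤ) ∣ NumberField.discr K) (hpN : ¬ p ^ 2 ∣ N)
    (hirr : Irr W p) (hr : W.analyticRank ≤ 1)
    (hI : padicValNat p (AddSubgroup.zmultiples P).index ≤
      padicValNat p ((W.baseChange ℚ_[q]).localTamagawaNumber ℤ_[q])) :
    ∀ x : W.sha, (p : ℤ) • x = 0 → x = 0 :=
  Typed.noPTorsion_of_padicValNat_shaOrder_eq_zero W p (hGZK W hr).2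
    (padicValNat_shaOrder_eq_zero_of_index_le_tamagawa hMJ W hK hH hP hnt p q hqN hcm hp2 hpD hpN
      hirr hr hI)

/-- **`BSD(E,p)` from the Jetchev–Cha certificate at a pair with `p ∤ #Ш_an`** (analytic rank
`≤ 1`; binders: Miller 2011 Thm. 5.4 under Cha's hypotheses `hMJ` [flag `Miller11-Thm54-Cha-case`]
and GZK `hGZK`; the certificate: `K` with `p ∤ d_K`, `p² ∤ N`, `P` of infinite order, one `q ∣ N`
with `ord_p [E(K) : ℤ P] ≤ ord_p c_q`, `p` odd, `E` non-CM, `ρ̄_{E,p}` irreducible, `ord_p #Ш_an = 0`).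
Per curve; not a class theorem. [cite: Miller2011LMS, Thm. 5.4 and Def. 1.1] -/
theorem bsdp_of_millerJetchev_of_index_le_tamagawa
    (hMJ : thm54_cha_padicValNat_shaOrder_add_tamagawa_le)
    (hGZK : rank_eq_analyticRank_of_analyticRank_le_one)
    (W : WeierstrassCurve ℚ) [W.IsElliptic] [W.IsGloballyMinimal] (p : ℕ) [Fact p.Prime]
    {N : ℕ} [NeZero N] {K : Type} [Field K] [NumberField K] (hK : IsImaginaryQuadratic K)
    (hH : SatisfiesHeegnerHypothesis N K) {P : (W.baseChange K).toAffine.Point}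
    (hP : IsHeegnerPoint N W K P) (hnt : ¬ IsOfFinAddOrder P)
    (q : ℕ) [Fact q.Prime] (hqN : q ∣ N)
    (hcm : ¬ W.HasCM) (hp2 : p ≠ 2) (hpD : ¬ (p : ℤ) ∣ NumberField.discr K) (hpN : ¬ p ^ 2 ∣ N)
    (hirr : Irr W p)
    (hI : padicValNat p (AddSubgroup.zmultiples P).index ≤
      padicValNat p ((W.baseChange ℚ_[q]).localTamagawaNumber ℤ_[q]))
    (hr : W.analyticRank ≤ 1) {s : ℚ} (hs : shaAn W = (s : ℂ)) (hv : padicValRat p s = 0) :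
    BSDp W p :=
  Typed.bsdp_of_shaAn_unit_of_noPTorsion W p hGZK hr hs hv
    (noPTorsion_of_millerJetchev_of_index_le_tamagawa hMJ hGZK W p hK hH hP hnt q hqN hcm hp2 hpD
      hpN hirr hr hI)

/-- **`BSD(E,p)` on the Jetchev–Cha-certificate locus of class X9, analytic rank `≤ 1`** — the
typed target `BSDpOnClassX9` delivered pointwise (in Miller's currency `BSDp`) over this file's
`ClassX9` at the TAMAGAWA-OBSTRUCTED pairs: the Galois hypotheses of Cha's theorem are automatic
(`E` non-CM, `E[p]` irreducible, `p ≥ 5` odd); the certificate is an imaginary quadratic `K` with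
the Heegner hypothesis for the level `N` and `p ∤ d_K`, `p² ∤ N`, a Heegner point `P` of infinite
order, ONE prime `q ∣ N` with `ord_p [E(K) : ℤ P] ≤ ord_p c_q`, and `#Ш_an = s` with `ord_p s = 0`.
Binders PUBLISHED: `hMJ` (Miller 2011 Thm. 5.4 under Cha's hypotheses, FLAG
`Miller11-Thm54-Cha-case`) and `hGZK` (bsd.S17). Not a class theorem; X9's label unchanged.
[cite: Miller2011LMS, Thm. 5.4 and Def. 1.1] [cite: Jetchev2008, Cor. 1.5 (p. 3)] -/
theorem bsdp_of_classX9_of_jetchevChaCertificate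
    (hMJ : thm54_cha_padicValNat_shaOrder_add_tamagawa_le)
    (hGZK : rank_eq_analyticRank_of_analyticRank_le_one)
    (W : WeierstrassCurve ℚ) [W.IsElliptic] [W.IsGloballyMinimal] (p : ℕ) [Fact p.Prime]
    (hX9 : ClassX9 W p) {N : ℕ} [NeZero N] {K : Type} [Field K] [NumberField K]
    (hK : IsImaginaryQuadratic K) (hH : SatisfiesHeegnerHypothesis N K)
    {P : (W.baseChange K).toAffine.Point} (hP : IsHeegnerPoint N W K P) (hnt : ¬ IsOfFinAddOrder P)
    (hpD : ¬ (p : ℤ) ∣ NumberField.discr K) (hpN : ¬ p ^ 2 ∣ N)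
    (q : ℕ) [Fact q.Prime] (hqN : q ∣ N)
    (hI : padicValNat p (AddSubgroup.zmultiples P).index ≤
      padicValNat p ((W.baseChange ℚ_[q]).localTamagawaNumber ℤ_[q]))
    (hran : W.analyticRank ≤ 1) {s : ℚ} (hs : shaAn W = (s : ℂ)) (hv : padicValRat p s = 0) :
    BSDp W p := by
  obtain ⟨hcm, h5, -, -, hirr, -⟩ := hX9
  have hp2 : p ≠ 2 := by omega
  exact bsdp_of_millerJetchev_of_index_le_tamagawa hMJ hGZK W p hK hH hP hnt q hqN hcm hp2 hpD hpN
    hirr hI hran hs hv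

/-- **X9: the typed missing input `Typed.X9.MissingInputAt` (= `MissingPPartAt`) is DISCHARGED,
pair by pair, by the Jetchev–Cha certificate** (for `p ∤ #Ш_an`). Bookkeeping only; the class
stays typed; flag `Miller11-Thm54-Cha-case` on the binder `hMJ`. [cite: Miller2011LMS, Thm. 5.4 and Def. 1.1] -/
theorem missingInputAt_of_classX9_of_jetchevChaCertificate
    (hMJ : thm54_cha_padicValNat_shaOrder_add_tamagawa_le)
    (hGZK : rank_eq_analyticRank_of_analyticRank_le_one)
    (W : WeierstrassCurve ℚ) [W.IsElliptic] [W.IsGloballyMinimal] (p : ℕ) [Fact p.Prime]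
    (hX9 : ClassX9 W p) {N : ℕ} [NeZero N] {K : Type} [Field K] [NumberField K]
    (hK : IsImaginaryQuadratic K) (hH : SatisfiesHeegnerHypothesis N K)
    {P : (W.baseChange K).toAffine.Point} (hP : IsHeegnerPoint N W K P) (hnt : ¬ IsOfFinAddOrder P)
    (hpD : ¬ (p : ℤ) ∣ NumberField.discr K) (hpN : ¬ p ^ 2 ∣ N)
    (q : ℕ) [Fact q.Prime] (hqN : q ∣ N)
    (hI : padicValNat p (AddSubgroup.zmultiples P).index ≤
      padicValNat p ((W.baseChange ℚ_[q]).localTamagawaNumber ℤ_[q]))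
    (hran : W.analyticRank ≤ 1) {s : ℚ} (hs : shaAn W = (s : ℂ)) (hv : padicValRat p s = 0) :
    Typed.X9.MissingInputAt W p := by
  obtain ⟨hcm, h5, -, -, hirr, -⟩ := hX9
  have hp2 : p ≠ 2 := by omega
  exact Typed.missingPPartAt_of_shaAn_unit_of_noPTorsion W p (hGZK W hran).2 hs hv
    (noPTorsion_of_millerJetchev_of_index_le_tamagawa hMJ hGZK W p hK hH hP hnt q hqN hcm hp2 hpD
      hpN hirr hran hI)

/-- **On the Jetchev–Cha-certificate locus of class X9 in analytic rank `0`, Greenberg's `μ = 0`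
holds** (same shape as gen 6's `mu_eq_zero_of_classX9_of_chaCertificate`, with the Tamagawa-
obstructed certificate): `BSDp W p` from the previous theorem and gen 5's μ-typing converse
`Rank1Residual.X9.mu_eq_zero_of_bsdp` (Burungale–Castella–Skinner 2025 Thm. 1.1.2 (a) `hBCS`,
Greenberg LNM 1716 Thm. 4.1 `hGr`, the period unit `h5`, modularity `hmodP`/`hmodL`, GZK, and the
finite analytic certificate `hcert` = one unit coefficient of `ϖ·L_p(f,α)`) give `D.mu = 0` for
every cyclotomic dual datum `D` of `X(E/ℚ_∞)`. Per pair; flag `Miller11-Thm54-Cha-case` on `hMJ`.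
[cite: Miller2011LMS, Thm. 5.4] [cite: GreenbergLNM1716, Conj. 1.11 and Thm. 4.1 (p. 102)]
[cite: BurungaleCastellaSkinner2025, Thm. 1.1.2 (a)] -/
theorem mu_eq_zero_of_classX9_of_jetchevChaCertificate
    (hMJ : thm54_cha_padicValNat_shaOrder_add_tamagawa_le)
    (hBCS : burungale_castella_skinner_charIdeal_eq_padicLFunction)
    (hGr : greenberg_charValue_rankZero) (h5 : realPeriodRat_eq_unit_mul_plusPeriod)
    (hmodP : nonempty_modularParametrizationData) (hmodL : hasEntireLFunction_rat)
    (hGZK : rank_eq_analyticRank_of_analyticRank_le_one)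
    (W : WeierstrassCurve ℚ) [W.IsElliptic] [W.IsGloballyMinimal] (p : ℕ) [Fact p.Prime]
    (hX9 : ClassX9 W p) (hr0 : W.analyticRank = 0) {N : ℕ} [NeZero N] {K : Type} [Field K]
    [NumberField K] (hK : IsImaginaryQuadratic K) (hH : SatisfiesHeegnerHypothesis N K)
    {P : (W.baseChange K).toAffine.Point} (hP : IsHeegnerPoint N W K P) (hnt : ¬ IsOfFinAddOrder P)
    (hpD : ¬ (p : ℤ) ∣ NumberField.discr K) (hpN : ¬ p ^ 2 ∣ N)
    (q : ℕ) [Fact q.Prime] (hqN : q ∣ N)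
    (hI : padicValNat p (AddSubgroup.zmultiples P).index ≤
      padicValNat p ((W.baseChange ℚ_[q]).localTamagawaNumber ℤ_[q]))
    {s : ℚ} (hs : shaAn W = (s : ℂ)) (hv : padicValRat p s = 0)
    (hcert : ∀ [NeZero (W.conductorNorm ℤ)] (f : CuspForm (Gamma0 (W.conductorNorm ℤ)) 2),
        IsNewformOf W f → ∀ (ϖ : ℚ), (ϖ : ℝ) * W.realPeriodRat = plusPeriod f →
      ∃ n : ℕ, ‖PowerSeries.coeff n
        (PowerSeries.C (ϖ : ℚ_[p]) * padicLFunction f (unitRoot W p : ℚ_[p]))‖ = 1) :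
    ∀ (κ : ZpExtension ℚ p) (γ : Field.absoluteGaloisGroup ℚ),
        κ.IsCyclotomic → κ.IsTopGenerator γ → IsCyclotomicVariable p γ →
      ∀ (D : W.SelmerDualData κ γ), D.mu = 0 := by
  have hbsd : BSDp W p :=
    bsdp_of_classX9_of_jetchevChaCertificate hMJ hGZK W p hX9 hK hH hP hnt hpD hpN q hqN hI
      (by omega) hs hv
  exact Literature.NumberTheory.EllipticCurves.Rank1Residual.X9.mu_eq_zero_of_bsdp W p hBCS hGr h5
    hmodP hmodL hGZK (classX9_census_of_classX9 W p hX9) hr0 hbsd hcert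

/-! ### The `Ш ≠ 0` rows: Miller's Thm. 5.4 as the UPPER half, Cassels–Tate + a descent certificate as the lower half -/

/-- **`ord_p #Ш_an = 2k` pairs: `BSD(E,p)` from the Jetchev–Cha index bound (upper half), Cassels–Tate
squareness and the certificate `p^{2k-1} ∣ #Ш(E/ℚ)` (lower half).** Analytic rank `≤ 1`; non-CM
`E`, odd `p`, `E[p]` irreducible, `K` Heegner with `p ∤ d_K`, `p² ∤ N`, `P` of infinite order, a
prime `q ∣ N` with `ord_p [E(K) : ℤ P] ≤ k + ord_p c_q` (so Miller's Thm. 5.4 gives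
`ord_p #Ш(E/ℚ) ≤ 2k`; `q` with `ord_p c_q = 0` recovers Cha's bound), `#Ш_an = s` with
`ord_p s = 2k`, and `p^{2k-1} ∣ #Ш(E/ℚ)` (one nonzero `p`-torsion class when `k = 1`; the tree's
`Typed.dvd_shaOrder_of_exists_torsion`). Binders: `hMJ` (FLAG `Miller11-Thm54-Cha-case`), `hGZK`
(bsd.S17), `hCT` (bsd.S18). Same shape as `Typed.bsdp_of_cha_of_casselsTate_of_dvd`
(`X10bHeegnerIndexCertificate.lean`) with the Tamagawa term. Per curve; not a class theorem.
Cell rows of this shape (first Heegner field, `p = 5`, `#Ш_an = 25`, rank 0): 131043s1, 219024bv1,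
219024bv2, 272484k2, 274752br1, 38088v1 (`ord_5 m = 1`, all `c_q` prime to 5: `k = 1`, `q` any) and
199988e1 (`ord_5 m = 2`, `c_173 = 5`: `k = 1`, `q = 173`); the lower certificate `Ш(E)[5] ≠ 0` is
NOT computed by this unit. [cite: Miller2011LMS, Thm. 5.4 and Def. 1.1] [cite: SilvermanAEC2009, Thm. X.4.14] -/
theorem bsdp_of_millerJetchev_of_casselsTate_of_pow_dvd
    (hMJ : thm54_cha_padicValNat_shaOrder_add_tamagawa_le)
    (hGZK : rank_eq_analyticRank_of_analyticRank_le_one)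
    (hCT : exists_casselsTate_pairing (K := ℚ))
    (W : WeierstrassCurve ℚ) [W.IsElliptic] [W.IsGloballyMinimal] (p : ℕ) [Fact p.Prime]
    {N : ℕ} [NeZero N] {K : Type} [Field K] [NumberField K] (hK : IsImaginaryQuadratic K)
    (hH : SatisfiesHeegnerHypothesis N K) {P : (W.baseChange K).toAffine.Point}
    (hP : IsHeegnerPoint N W K P) (hnt : ¬ IsOfFinAddOrder P)
    (q : ℕ) [Fact q.Prime] (hqN : q ∣ N)
    (hcm : ¬ W.HasCM) (hp2 : p ≠ 2) (hpD : ¬ (p : ℤ) ∣ NumberField.discr K) (hpN : ¬ p ^ 2 ∣ N)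
    (hirr : Irr W p) (hr : W.analyticRank ≤ 1) {k : ℕ}
    (hI : padicValNat p (AddSubgroup.zmultiples P).index ≤
      k + padicValNat p ((W.baseChange ℚ_[q]).localTamagawaNumber ℤ_[q]))
    {s : ℚ} (hs : shaAn W = (s : ℂ)) (hv : padicValRat p s = 2 * k)
    (hdvd : p ^ (2 * k - 1) ∣ W.shaOrder) : BSDp W p := by
  have hup : padicValNat p W.shaOrder ≤ 2 * (k + padicValNat p
      ((W.baseChange ℚ_[q]).localTamagawaNumber ℤ_[q]) -
      padicValNat p ((W.baseChange ℚ_[q]).localTamagawaNumber ℤ_[q])) :=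
    padicValNat_shaOrder_le_of_index_sub_tamagawa hMJ W hK hH hP hnt p q hqN hcm hp2 hpD hpN hirr
      hr hI le_rfl
  have hup' : padicValNat p W.shaOrder ≤ 2 * k := by omega
  have hU : Typed.MissingUpperBoundAt W p := by
    refine ⟨s, hs, ?_⟩
    rw [hv]
    exact_mod_cast hup'
  exact Typed.bsdp_of_missingPPartAt W p hGZK hr
    (Typed.missingPPartAt_of_lower_of_upper W p
      (Typed.missingLowerBoundAt_of_casselsTate_of_pow_dvd W p hCT (hGZK W hr).2 hs hv.le hdvd) hU)

end Summit.BirchSwinnertonDyer.BirchSwinnertonDyer.Rank1Residual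

end
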